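import Literature.Probability.LatticeModels.MTP2WeakClosure
import HarnessLib

/-!
# Density-free MTP₂ is preserved by continuous log-supermodular tilts (Gibbs modifications)

For densities, "a product of MTP₂ functions is MTP₂" is the triviality recorded by Karlin–Rinott
[cite: KarlinRinott1980, §1 (1.14) ("if `f(x)` and `g(x)` are MTP₂ densities, then `f(x)g(x)` is MTP₂ by (1.14)")
and §3 Prop. 3.3].  This file proves the **measure-level** statement for the density-free MTP₂ notion of
Colangelo–Müller–Scarsini (Definition 2 = `mIsSetTP2`: `µ(A)µ(B) ≤ µ(A ∧ B)µ(A ∨ B)` for all Borel `A, B`):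

* `mIsSetTP2.withDensity_of_continuous` — if `µ` is a finite MTP₂ measure on `ℝ^ι` (`ι` finite; no density
  assumed, singular `µ` allowed) and `ρ : ℝ^ι → ℝ≥0` is continuous, bounded and MTP₂
  (`ρ(x)ρ(y) ≤ ρ(x ∧ y)ρ(x ∨ y)`), then the tilted measure `ρ • µ := µ.withDensity ρ` is MTP₂;
* `mIsSetTP2.withDensity_exp_neg` — in particular `e^{-H} • µ` for every continuous submodular `H` bounded below
  (finite-volume Gibbs modifications with a singular a-priori measure);
* the same in the box vocabulary (c′) of CMS Theorem 1 (`CMSCondC'.withDensity_of_continuous`) and for affiliated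
  measures (`mIsAffiliated.withDensity_of_continuous`).

**Status in print.**  The measure-level statement is *not* stated in [KarlinRinott1980] (densities only), in
Müller–Stoyan (Thm. 3.10.14 assumes a density) or in [ColangeloMullerScarsini2006] (Thm. 3 lists B1–B7: PQD pairs,
Fréchet bounds, independence, increasing maps, permutations, weak limits, margins).  It is, however, a three-line
corollary of CMS Theorem 1 (a) ⇒ (e) (MTP₂ laws are weak limits of lattice laws with MTP₂ point masses), KR (1.14)
applied to the point masses `ρ(q)µₙ{q}` of the tilted approximants, and CMS Theorem 2 (weak closure), for bounded
continuous `ρ`.  [cite: ColangeloMullerScarsini2006, Thm. 1 (a) ⇒ (e) and Thm. 2 (corollary; not stated there)]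

**Proof given here** (the direct cell-sum form of that route, without normalising to probability measures): for
compact `A, B` and the dyadic discretisation `φₙ = discretize n` (a lattice homomorphism),
`∫_A ρ∘φₙ dµ = Σ_q ρ(q) µ(A ∩ φₙ⁻¹q)`; the four functions `q ↦ ρ(q)µ(E ∩ φₙ⁻¹q)` (`E = A, B, A ∧ B, A ∨ B`) satisfy
the hypothesis of the Ahlswede–Daykin four functions theorem on the lattice `ℝ^ι` because `ρ` is MTP₂, `µ` is MTP₂
on the Borel pieces `A ∩ φₙ⁻¹a`, `B ∩ φₙ⁻¹b`, and `(A ∩ φₙ⁻¹a) ∧ (B ∩ φₙ⁻¹b) ⊆ (A ∧ B) ∩ φₙ⁻¹(a ∧ b)`; hence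
`∫_A ρ∘φₙ dµ · ∫_B ρ∘φₙ dµ ≤ ∫_{A∧B} ρ∘φₙ dµ · ∫_{A∨B} ρ∘φₙ dµ`, and `n → ∞` by dominated convergence
(`ρ∘φₙ → ρ` pointwise by continuity, `ρ` bounded, `µ` finite); Borel sets by inner regularity.
The Sahi cell's Summits-side `IsBoxTP2.withDensity_of_continuous` (unit cube, step densities and a cofinal-level
lattice criterion) is an independent formalisation of the same fact in the box vocabulary.
-/

noncomputable section

namespace Literature.Probability.LatticeModels.Affiliation

open MeasureTheory Set Filter Topology Function Metric
open scoped ENNReal NNReal SetFamily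

variable {ι : Type*} [Fintype ι]

section CellSums

/-- **Cell sums.**  On a measurable set `E` whose `φₙ`-image lies in the finite set `S`,
`∫_E ρ(φₙ x) dµ = Σ_{q ∈ S} ρ(q) µ(E ∩ φₙ⁻¹{q})` (the integrand is constant on each fibre).
[cite: ColangeloMullerScarsini2006, proof of Thm. 1 (b) ⇒ (a) (`µ(A) = Σ_Q f_Q`), with the weight `ρ`] -/
theorem setLIntegral_comp_discretize_eq_sum (μ : Measure (ι → ℝ)) (ρ : (ι → ℝ) → ℝ≥0∞) (n : ℕ)
    {E : Set (ι → ℝ)} (hE : MeasurableSet E) {S : Finset (ι → ℝ)} (hS : discretize n '' E ⊆ ↑S) :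
    ∫⁻ x in E, ρ (discretize n x) ∂μ = ∑ q ∈ S, ρ q * μ (E ∩ discretize n ⁻¹' {q}) := by
  classical
  have hmeas : ∀ q ∈ S, MeasurableSet (E ∩ discretize n ⁻¹' {q}) := fun q _ =>
    hE.inter (measurable_discretize n (measurableSet_singleton q))
  have hdisj : Set.PairwiseDisjoint (↑S : Set (ι → ℝ)) (fun q => E ∩ discretize n ⁻¹' {q}) :=
    fun q _ q' _ hne => ((Set.disjoint_singleton.2 hne).preimage (discretize n)).mono
      inter_subset_right inter_subset_right
  have hEU : E = ⋃ q ∈ S, (E ∩ discretize n ⁻¹' {q}) := by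
    refine Subset.antisymm (fun x hx => ?_) (iUnion₂_subset fun q _ => inter_subset_left)
    exact mem_iUnion₂.2 ⟨discretize n x, hS (mem_image_of_mem _ hx), hx, rfl⟩
  calc ∫⁻ x in E, ρ (discretize n x) ∂μ
      = ∫⁻ x in ⋃ q ∈ S, (E ∩ discretize n ⁻¹' {q}), ρ (discretize n x) ∂μ := by rw [← hEU]
    _ = ∑ q ∈ S, ∫⁻ x in E ∩ discretize n ⁻¹' {q}, ρ (discretize n x) ∂μ :=
        lintegral_biUnion_finset hdisj hmeas _
    _ = ∑ q ∈ S, ρ q * μ (E ∩ discretize n ⁻¹' {q}) := by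
        refine Finset.sum_congr rfl fun q hq => ?_
        rw [setLIntegral_congr_fun (hmeas q hq)
          (fun x hx => show ρ (discretize n x) = ρ q by rw [show discretize n x = q from hx.2]),
          setLIntegral_const]

/-- Real-valued form of the cell sum for a finite measure and a bounded weight: the `toReal` of
`∫_E ρ∘φₙ dµ` is `Σ_{q ∈ S} ρ(q) µ.real(E ∩ φₙ⁻¹{q})`. [cite: ColangeloMullerScarsini2006, proof of Thm. 1 (b) ⇒ (a)] -/
theorem toReal_setLIntegral_comp_discretize (μ : Measure (ι → ℝ)) [IsFiniteMeasure μ] (ρ : (ι → ℝ) → ℝ≥0)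
    (n : ℕ) {E : Set (ι → ℝ)} (hE : MeasurableSet E) {S : Finset (ι → ℝ)} (hS : discretize n '' E ⊆ ↑S) :
    (∫⁻ x in E, (ρ (discretize n x) : ℝ≥0∞) ∂μ).toReal =
      ∑ q ∈ S, (ρ q : ℝ) * μ.real (E ∩ discretize n ⁻¹' {q}) := by
  rw [setLIntegral_comp_discretize_eq_sum μ (fun x => (ρ x : ℝ≥0∞)) n hE hS, ENNReal.toReal_sum]
  · refine Finset.sum_congr rfl fun q _ => ?_
    rw [ENNReal.toReal_mul, ENNReal.coe_toReal, measureReal_def]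
  · intro q _
    exact ENNReal.mul_ne_top ENNReal.coe_ne_top (measure_ne_top _ _)

omit [Fintype ι] in
/-- The image of `A ∧ B` under the lattice homomorphism `φₙ` lies in `φₙ(A) ∧ φₙ(B)`.
[cite: ColangeloMullerScarsini2006, proof of Thm. 1 (b) ⇒ (a)] -/
theorem image_discretize_infs_subset (n : ℕ) (A B : Set (ι → ℝ)) :
    discretize n '' (A ⊼ B) ⊆ discretize n '' A ⊼ discretize n '' B := by
  rintro _ ⟨_, ⟨x, hx, y, hy, rfl⟩, rfl⟩
  exact ⟨discretize n x, mem_image_of_mem _ hx, discretize n y, mem_image_of_mem _ hy,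
    (discretize_inf n x y).symm⟩

omit [Fintype ι] in
/-- The image of `A ∨ B` under `φₙ` lies in `φₙ(A) ∨ φₙ(B)`. [cite: ColangeloMullerScarsini2006, proof of
Thm. 1 (b) ⇒ (a)] -/
theorem image_discretize_sups_subset (n : ℕ) (A B : Set (ι → ℝ)) :
    discretize n '' (A ⊻ B) ⊆ discretize n '' A ⊻ discretize n '' B := by
  rintro _ ⟨_, ⟨x, hx, y, hy, rfl⟩, rfl⟩
  exact ⟨discretize n x, mem_image_of_mem _ hx, discretize n y, mem_image_of_mem _ hy,
    (discretize_sup n x y).symm⟩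

end CellSums

section Tilt

/-- **The four-functions hypothesis for the tilted cell weights**: if `µ` is MTP₂ (Definition 2) and `ρ` is MTP₂,
then for Borel `A, B` and lattice points `a, b`,
`ρ(a)µ(A ∩ φₙ⁻¹a) · ρ(b)µ(B ∩ φₙ⁻¹b) ≤ ρ(a∧b)µ((A∧B) ∩ φₙ⁻¹(a∧b)) · ρ(a∨b)µ((A∨B) ∩ φₙ⁻¹(a∨b))`
— "a product of MTP₂ functions is MTP₂". [cite: KarlinRinott1980, (1.14); ColangeloMullerScarsini2006, Def. 2] -/
theorem mIsSetTP2.tilt_cell_four {μ : Measure (ι → ℝ)} [IsFiniteMeasure μ] (hμ : mIsSetTP2 μ)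
    {ρ : (ι → ℝ) → ℝ≥0} (hρ : ∀ x y, ρ x * ρ y ≤ ρ (x ⊓ y) * ρ (x ⊔ y)) (n : ℕ) {A B : Set (ι → ℝ)}
    (hA : MeasurableSet A) (hB : MeasurableSet B) (a b : ι → ℝ) :
    (ρ a : ℝ) * μ.real (A ∩ discretize n ⁻¹' {a}) * ((ρ b : ℝ) * μ.real (B ∩ discretize n ⁻¹' {b})) ≤
      (ρ (a ⊓ b) : ℝ) * μ.real ((A ⊼ B) ∩ discretize n ⁻¹' {a ⊓ b}) *
        ((ρ (a ⊔ b) : ℝ) * μ.real ((A ⊻ B) ∩ discretize n ⁻¹' {a ⊔ b})) := by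
  have h1 : (ρ a : ℝ) * ρ b ≤ ρ (a ⊓ b) * ρ (a ⊔ b) := by exact_mod_cast hρ a b
  have hA' : MeasurableSet (A ∩ discretize n ⁻¹' {a}) :=
    hA.inter (measurable_discretize n (measurableSet_singleton a))
  have hB' : MeasurableSet (B ∩ discretize n ⁻¹' {b}) :=
    hB.inter (measurable_discretize n (measurableSet_singleton b))
  have hsub1 : (A ∩ discretize n ⁻¹' {a}) ⊼ (B ∩ discretize n ⁻¹' {b}) ⊆
      (A ⊼ B) ∩ discretize n ⁻¹' {a ⊓ b} := by
    rintro _ ⟨x, ⟨hxA, hxa⟩, y, ⟨hyB, hyb⟩, rfl⟩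
    refine ⟨⟨x, hxA, y, hyB, rfl⟩, ?_⟩
    rw [mem_preimage, mem_singleton_iff] at hxa hyb ⊢
    rw [discretize_inf, hxa, hyb]
  have hsub2 : (A ∩ discretize n ⁻¹' {a}) ⊻ (B ∩ discretize n ⁻¹' {b}) ⊆
      (A ⊻ B) ∩ discretize n ⁻¹' {a ⊔ b} := by
    rintro _ ⟨x, ⟨hxA, hxa⟩, y, ⟨hyB, hyb⟩, rfl⟩
    refine ⟨⟨x, hxA, y, hyB, rfl⟩, ?_⟩
    rw [mem_preimage, mem_singleton_iff] at hxa hyb ⊢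
    rw [discretize_sup, hxa, hyb]
  have h2 : μ.real (A ∩ discretize n ⁻¹' {a}) * μ.real (B ∩ discretize n ⁻¹' {b}) ≤
      μ.real ((A ⊼ B) ∩ discretize n ⁻¹' {a ⊓ b}) * μ.real ((A ⊻ B) ∩ discretize n ⁻¹' {a ⊔ b}) := by
    have key := (hμ hA' hB').trans (mul_le_mul' (measure_mono hsub1) (measure_mono hsub2))
    simp only [measureReal_def, ← ENNReal.toReal_mul]
    exact ENNReal.toReal_mono (ENNReal.mul_ne_top (measure_ne_top _ _) (measure_ne_top _ _)) key
  calc (ρ a : ℝ) * μ.real (A ∩ discretize n ⁻¹' {a}) * ((ρ b : ℝ) * μ.real (B ∩ discretize n ⁻¹' {b}))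
      = ((ρ a : ℝ) * ρ b) *
          (μ.real (A ∩ discretize n ⁻¹' {a}) * μ.real (B ∩ discretize n ⁻¹' {b})) := by ring
    _ ≤ ((ρ (a ⊓ b) : ℝ) * ρ (a ⊔ b)) * (μ.real ((A ⊼ B) ∩ discretize n ⁻¹' {a ⊓ b}) *
          μ.real ((A ⊻ B) ∩ discretize n ⁻¹' {a ⊔ b})) :=
        mul_le_mul h1 h2 (mul_nonneg measureReal_nonneg measureReal_nonneg) (by positivity)
    _ = _ := by ring

open scoped FinsetFamily in
/-- **Level-`n` inequality for the tilted cell sums** (four functions theorem on the lattice `ℝ^ι`): for compact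
`A, B`, `∫_A ρ∘φₙ dµ · ∫_B ρ∘φₙ dµ ≤ ∫_{A∧B} ρ∘φₙ dµ · ∫_{A∨B} ρ∘φₙ dµ`.
[cite: KarlinRinott1980, (1.14) and Cor. 2.1; ColangeloMullerScarsini2006, proof of Thm. 1 (b) ⇒ (a)] -/
theorem mIsSetTP2.tilt_level_tp2 {μ : Measure (ι → ℝ)} [IsFiniteMeasure μ] (hμ : mIsSetTP2 μ)
    {ρ : (ι → ℝ) → ℝ≥0} (hρ : ∀ x y, ρ x * ρ y ≤ ρ (x ⊓ y) * ρ (x ⊔ y)) {C : ℝ≥0} (hC : ∀ x, ρ x ≤ C)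
    (n : ℕ) {A B : Set (ι → ℝ)} (hA : IsCompact A) (hB : IsCompact B) :
    (lintegral (μ.restrict A) fun x => (ρ (discretize n x) : ℝ≥0∞)) *
        (lintegral (μ.restrict B) fun x => (ρ (discretize n x) : ℝ≥0∞)) ≤
      (lintegral (μ.restrict (A ⊼ B)) fun x => (ρ (discretize n x) : ℝ≥0∞)) *
        (lintegral (μ.restrict (A ⊻ B)) fun x => (ρ (discretize n x) : ℝ≥0∞)) := by
  -- (`∂µ` is not written in this statement: the `FinsetFamily` scope needed for `S ⊼ T` below also binds `∂`.)
  classical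
  -- finiteness of all the integrals
  have hfin : ∀ E : Set (ι → ℝ), (lintegral (μ.restrict E) fun x => (ρ (discretize n x) : ℝ≥0∞)) ≠ ∞ :=
      fun E => by
    refine ne_top_of_le_ne_top
      (ENNReal.mul_ne_top (ENNReal.coe_ne_top (r := C)) (measure_ne_top (μ.restrict E) univ)) ?_
    rw [← lintegral_const]
    exact lintegral_mono fun x => ENNReal.coe_le_coe.2 (hC _)
  -- the finite sets of lattice points
  set S := (finite_image_discretize n hA.isBounded).toFinset with hSdef
  set T := (finite_image_discretize n hB.isBounded).toFinset with hTdef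
  have hS : discretize n '' A ⊆ ↑S := by rw [hSdef, Finite.coe_toFinset]
  have hT : discretize n '' B ⊆ ↑T := by rw [hTdef, Finite.coe_toFinset]
  have hST : discretize n '' (A ⊼ B) ⊆ ↑(S ⊼ T) := by
    rw [Finset.coe_infs]; exact (image_discretize_infs_subset n A B).trans (Set.infs_subset hS hT)
  have hST' : discretize n '' (A ⊻ B) ⊆ ↑(S ⊻ T) := by
    rw [Finset.coe_sups]; exact (image_discretize_sups_subset n A B).trans (Set.sups_subset hS hT)
  have hAm := hA.measurableSet
  have hBm := hB.measurableSet
  have hABm := (isCompact_infs hA hB).measurableSet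
  have hABm' := (isCompact_sups hA hB).measurableSet
  -- the four functions
  set f₁ : (ι → ℝ) → ℝ := fun q => (ρ q : ℝ) * μ.real (A ∩ discretize n ⁻¹' {q})
  set f₂ : (ι → ℝ) → ℝ := fun q => (ρ q : ℝ) * μ.real (B ∩ discretize n ⁻¹' {q})
  set f₃ : (ι → ℝ) → ℝ := fun q => (ρ q : ℝ) * μ.real ((A ⊼ B) ∩ discretize n ⁻¹' {q})
  set f₄ : (ι → ℝ) → ℝ := fun q => (ρ q : ℝ) * μ.real ((A ⊻ B) ∩ discretize n ⁻¹' {q})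
  have h0 : ∀ (E : Set (ι → ℝ)), (0 : (ι → ℝ) → ℝ) ≤ fun q => (ρ q : ℝ) * μ.real (E ∩ discretize n ⁻¹' {q}) :=
    fun E q => mul_nonneg (NNReal.coe_nonneg _) measureReal_nonneg
  have key : (∑ a ∈ S, f₁ a) * ∑ a ∈ T, f₂ a ≤ (∑ a ∈ S ⊼ T, f₃ a) * ∑ a ∈ S ⊻ T, f₄ a :=
    four_functions_theorem f₁ f₂ f₃ f₄ (h0 A) (h0 B) (h0 (A ⊼ B)) (h0 (A ⊻ B))
      (fun a b => hμ.tilt_cell_four hρ n hAm hBm a b) S T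
  rw [← toReal_setLIntegral_comp_discretize μ ρ n hAm hS, ← toReal_setLIntegral_comp_discretize μ ρ n hBm hT,
    ← toReal_setLIntegral_comp_discretize μ ρ n hABm hST,
    ← toReal_setLIntegral_comp_discretize μ ρ n hABm' hST', ← ENNReal.toReal_mul, ← ENNReal.toReal_mul] at key
  exact (ENNReal.toReal_le_toReal (ENNReal.mul_ne_top (hfin _) (hfin _))
    (ENNReal.mul_ne_top (hfin _) (hfin _))).1 key

/-- **Dominated convergence for the tilted cell sums**: `∫_E ρ∘φₙ dµ → ∫_E ρ dµ` (`ρ∘φₙ → ρ` pointwise since `ρ`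
is continuous and `φₙ x → x`; `ρ` bounded, `µ` finite). [cite: ColangeloMullerScarsini2006, proof of Thm. 1
(c) ⇒ (e) (`µₙ →w µ`)] -/
theorem tendsto_setLIntegral_comp_discretize (μ : Measure (ι → ℝ)) [IsFiniteMeasure μ] {ρ : (ι → ℝ) → ℝ≥0}
    (hρc : Continuous ρ) {C : ℝ≥0} (hC : ∀ x, ρ x ≤ C) (E : Set (ι → ℝ)) :
    Tendsto (fun n => ∫⁻ x in E, (ρ (discretize n x) : ℝ≥0∞) ∂μ) atTop
      (𝓝 (∫⁻ x in E, (ρ x : ℝ≥0∞) ∂μ)) := by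
  have hρm : Measurable fun x => (ρ x : ℝ≥0∞) := (ENNReal.continuous_coe.comp hρc).measurable
  refine tendsto_lintegral_of_dominated_convergence (fun _ => (C : ℝ≥0∞))
    (fun n => hρm.comp (measurable_discretize n)) (fun n => ae_of_all _ fun x => ?_) ?_
    (ae_of_all _ fun x => ?_)
  · exact ENNReal.coe_le_coe.2 (hC _)
  · rw [lintegral_const]
    exact ENNReal.mul_ne_top ENNReal.coe_ne_top (measure_ne_top _ _)
  · exact ((ENNReal.continuous_coe.comp hρc).tendsto x).comp (tendsto_discretize x)

omit [Fintype ι] in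
/-- The tilt of a finite measure by a bounded weight is a finite measure (plumbing). [folklore] -/
private theorem isFiniteMeasure_withDensity_of_le (μ : Measure (ι → ℝ)) [IsFiniteMeasure μ] {ρ : (ι → ℝ) → ℝ≥0}
    {C : ℝ≥0} (hC : ∀ x, ρ x ≤ C) : IsFiniteMeasure (μ.withDensity fun x => (ρ x : ℝ≥0∞)) := by
  refine isFiniteMeasure_withDensity (ne_top_of_le_ne_top ?_ (lintegral_mono fun x => ENNReal.coe_le_coe.2 (hC x)))
  rw [lintegral_const]
  exact ENNReal.mul_ne_top ENNReal.coe_ne_top (measure_ne_top _ _)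

/-- **Compact sets**: for an MTP₂ finite measure `µ` and a continuous bounded MTP₂ weight `ρ`, the tilted measure
satisfies inequality (2) on every pair of compact sets. [cite: ColangeloMullerScarsini2006, Def. 2 and Thms. 1–2
(corollary); KarlinRinott1980, (1.14)] -/
theorem mIsSetTP2.withDensity_isCompact_tp2 {μ : Measure (ι → ℝ)} [IsFiniteMeasure μ] (hμ : mIsSetTP2 μ)
    {ρ : (ι → ℝ) → ℝ≥0} (hρc : Continuous ρ) (hρ : ∀ x y, ρ x * ρ y ≤ ρ (x ⊓ y) * ρ (x ⊔ y)) {C : ℝ≥0}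
    (hC : ∀ x, ρ x ≤ C) {A B : Set (ι → ℝ)} (hA : IsCompact A) (hB : IsCompact B) :
    (μ.withDensity fun x => (ρ x : ℝ≥0∞)) A * (μ.withDensity fun x => (ρ x : ℝ≥0∞)) B ≤
      (μ.withDensity fun x => (ρ x : ℝ≥0∞)) (A ⊼ B) * (μ.withDensity fun x => (ρ x : ℝ≥0∞)) (A ⊻ B) := by
  rw [withDensity_apply _ hA.measurableSet, withDensity_apply _ hB.measurableSet,
    withDensity_apply _ (isCompact_infs hA hB).measurableSet,
    withDensity_apply _ (isCompact_sups hA hB).measurableSet]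
  have hne : ∀ E : Set (ι → ℝ), ∫⁻ x in E, (ρ x : ℝ≥0∞) ∂μ ≠ ∞ := fun E => by
    refine ne_top_of_le_ne_top
      (ENNReal.mul_ne_top (ENNReal.coe_ne_top (r := C)) (measure_ne_top (μ.restrict E) univ)) ?_
    rw [← lintegral_const]
    exact lintegral_mono fun x => ENNReal.coe_le_coe.2 (hC _)
  have hl := tendsto_setLIntegral_comp_discretize μ hρc hC
  exact le_of_tendsto_of_tendsto'
    (ENNReal.Tendsto.mul (hl A) (Or.inr (hne B)) (hl B) (Or.inr (hne A)))
    (ENNReal.Tendsto.mul (hl (A ⊼ B)) (Or.inr (hne (A ⊻ B))) (hl (A ⊻ B)) (Or.inr (hne (A ⊼ B))))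
    fun n => hμ.tilt_level_tp2 hρ hC n hA hB

/-- **Density-free MTP₂ is preserved by continuous bounded log-supermodular tilts.**  If `µ` is a finite measure
on `ℝ^ι` that is MTP₂ in the sense of Definition 2 (no density; singular `µ` allowed) and `ρ : ℝ^ι → ℝ≥0` is
continuous, bounded and MTP₂ (`ρ(x)ρ(y) ≤ ρ(x∧y)ρ(x∨y)`), then `ρ • µ = µ.withDensity ρ` is MTP₂.
For densities this is "a product of MTP₂ functions is MTP₂" [cite: KarlinRinott1980, (1.14)]; the measure-level
statement is a corollary of [cite: ColangeloMullerScarsini2006, Thm. 1 (a) ⇒ (e) and Thm. 2] (not stated there);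
proof here by cell sums, the four functions theorem, dominated convergence and inner regularity. -/
theorem mIsSetTP2.withDensity_of_continuous {μ : Measure (ι → ℝ)} [IsFiniteMeasure μ] (hμ : mIsSetTP2 μ)
    {ρ : (ι → ℝ) → ℝ≥0} (hρc : Continuous ρ) (hρ : ∀ x y, ρ x * ρ y ≤ ρ (x ⊓ y) * ρ (x ⊔ y)) {C : ℝ≥0}
    (hC : ∀ x, ρ x ≤ C) : mIsSetTP2 (μ.withDensity fun x => (ρ x : ℝ≥0∞)) := by
  haveI := isFiniteMeasure_withDensity_of_le μ hC
  set ν := μ.withDensity fun x => (ρ x : ℝ≥0∞) with hν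
  intro A B hA hB
  set R := ν (A ⊼ B) * ν (A ⊻ B) with hR
  have hK : ∀ K, K ⊆ A → IsCompact K → ∀ K', K' ⊆ B → IsCompact K' → ν K * ν K' ≤ R :=
    fun K hKA hK K' hK'B hK' => (hμ.withDensity_isCompact_tp2 hρc hρ hC hK hK').trans
      (mul_le_mul' (measure_mono (Set.infs_subset hKA hK'B)) (measure_mono (Set.sups_subset hKA hK'B)))
  rw [hA.measure_eq_iSup_isCompact_of_ne_top (measure_ne_top ν A),
    hB.measure_eq_iSup_isCompact_of_ne_top (measure_ne_top ν B)]
  rw [ENNReal.iSup_mul]; refine iSup_le fun K => ?_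
  rw [ENNReal.iSup_mul]; refine iSup_le fun hKA => ?_
  rw [ENNReal.iSup_mul]; refine iSup_le fun hKc => ?_
  rw [ENNReal.mul_iSup]; refine iSup_le fun K' => ?_
  rw [ENNReal.mul_iSup]; refine iSup_le fun hK'B => ?_
  rw [ENNReal.mul_iSup]; exact iSup_le fun hK'c => hK K hKA hKc K' hK'B hK'c

/-- **Gibbs modifications**: for a finite MTP₂ measure `µ` on `ℝ^ι` (Definition 2) and a continuous submodular
`H` (`H(x∧y) + H(x∨y) ≤ H(x) + H(y)`) bounded below, the measure `e^{-H} • µ` is MTP₂ — the finite-volume Gibbs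
measure of a ferromagnetic (submodular) continuous-spin interaction with an arbitrary MTP₂ (e.g. product, or
singular comonotone) a-priori measure.  Density case: [cite: KarlinRinott1980, (1.14) and Thm. 2.3 (= Preston's FKG
for MTP₂ densities)]; measure level: corollary of [cite: ColangeloMullerScarsini2006, Thms. 1–2]. -/
theorem mIsSetTP2.withDensity_exp_neg {μ : Measure (ι → ℝ)} [IsFiniteMeasure μ] (hμ : mIsSetTP2 μ)
    {H : (ι → ℝ) → ℝ} (hHc : Continuous H) (hsub : ∀ x y, H (x ⊓ y) + H (x ⊔ y) ≤ H x + H y)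
    {m : ℝ} (hm : ∀ x, m ≤ H x) :
    mIsSetTP2 (μ.withDensity fun x => ENNReal.ofReal (Real.exp (-H x))) := by
  have h := hμ.withDensity_of_continuous (ρ := fun x => (Real.exp (-H x)).toNNReal)
    (continuous_real_toNNReal.comp (Real.continuous_exp.comp hHc.neg)) (fun x y => ?_)
    (C := (Real.exp (-m)).toNNReal) (fun x => Real.toNNReal_le_toNNReal
      (Real.exp_le_exp.2 (neg_le_neg (hm x))))
  · exact h
  · rw [← Real.toNNReal_mul (Real.exp_pos _).le, ← Real.toNNReal_mul (Real.exp_pos _).le,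
      ← Real.exp_add, ← Real.exp_add]
    exact Real.toNNReal_le_toNNReal (Real.exp_le_exp.2 (by linarith [hsub x y]))

/-- The tilt theorem in the box vocabulary (c′) of CMS Theorem 1 (inequality (2) for all pairs of closed boxes —
the Sahi cell's `IsBoxTP2`): box-TP₂ finite measures on `ℝ^ι` are preserved by continuous bounded MTP₂ tilts.
[cite: ColangeloMullerScarsini2006, Thm. 1 (a) ⟺ (c′) with Thms. 1–2 (corollary); KarlinRinott1980, (1.14)] -/
theorem CMSCondC'.withDensity_of_continuous {μ : Measure (ι → ℝ)} [IsFiniteMeasure μ] (hμ : CMSCondC' μ)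
    {ρ : (ι → ℝ) → ℝ≥0} (hρc : Continuous ρ) (hρ : ∀ x y, ρ x * ρ y ≤ ρ (x ⊓ y) * ρ (x ⊔ y)) {C : ℝ≥0}
    (hC : ∀ x, ρ x ≤ C) : CMSCondC' (μ.withDensity fun x => (ρ x : ℝ≥0∞)) :=
  (hμ.mIsSetTP2.withDensity_of_continuous hρc hρ hC).cmsCondC'

/-- The tilt theorem for affiliated measures (Milgrom–Weber; CMS Theorem 1 (d)): affiliation of a finite measure on
`ℝ^ι` is preserved by continuous bounded MTP₂ tilts. [cite: ColangeloMullerScarsini2006, Thm. 1 (a) ⟺ (d) with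
Thms. 1–2 (corollary); KarlinRinott1980, (1.14)] -/
theorem mIsAffiliated.withDensity_of_continuous {μ : Measure (ι → ℝ)} [IsFiniteMeasure μ]
    (hμ : mIsAffiliated μ) {ρ : (ι → ℝ) → ℝ≥0} (hρc : Continuous ρ)
    (hρ : ∀ x y, ρ x * ρ y ≤ ρ (x ⊓ y) * ρ (x ⊔ y)) {C : ℝ≥0} (hC : ∀ x, ρ x ≤ C) :
    mIsAffiliated (μ.withDensity fun x => (ρ x : ℝ≥0∞)) := by
  haveI := isFiniteMeasure_withDensity_of_le μ hC
  exact (mIsSetTP2_iff_mIsAffiliated_pi _).1 (hμ.mIsSetTP2_pi.withDensity_of_continuous hρc hρ hC)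

end Tilt

/-! ## Unbounded weights: localisation to boxes -/

section Unbounded

/-- **Restriction to a measurable sublattice preserves Definition 2**: if `S` is measurable, sup- and inf-closed,
then `µ|_S` is MTP₂ whenever `µ` is (`(A ∩ S) ∧ (B ∩ S) ⊆ (A ∧ B) ∩ S`).  [cite: ColangeloMullerScarsini2006,
Def. 2; MullerStoyan2002, Def. 3.10.13 (constrictions to sublattices)] -/
theorem mIsSetTP2.restrict_of_latticeClosed {Ω : Type*} [MeasurableSpace Ω] [Lattice Ω] {μ : Measure Ω}
    (hμ : mIsSetTP2 μ) {S : Set Ω} (hS : MeasurableSet S) (hsup : SupClosed S) (hinf : InfClosed S) :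
    mIsSetTP2 (μ.restrict S) := by
  intro A B hA hB
  rw [Measure.restrict_apply' hS, Measure.restrict_apply' hS, Measure.restrict_apply' hS,
    Measure.restrict_apply' hS]
  refine (hμ (hA.inter hS) (hB.inter hS)).trans (mul_le_mul' (measure_mono ?_) (measure_mono ?_))
  · rintro _ ⟨x, ⟨hxA, hxS⟩, y, ⟨hyB, hyS⟩, rfl⟩
    exact ⟨⟨x, hxA, y, hyB, rfl⟩, hinf hxS hyS⟩
  · rintro _ ⟨x, ⟨hxA, hxS⟩, y, ⟨hyB, hyS⟩, rfl⟩
    exact ⟨⟨x, hxA, y, hyB, rfl⟩, hsup hxS hyS⟩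

/-- Clamping a real to `[-N, N]`, `t ↦ max (-N) (min t N)`, is monotone (plumbing). [folklore] -/
private theorem clampR_mono (N : ℝ) : Monotone (fun t : ℝ => max (-N) (min t N)) := fun _ _ h =>
  max_le_max le_rfl (min_le_min h le_rfl)

/-- Clamping is continuous (plumbing). [folklore] -/
private theorem continuous_clampR (N : ℝ) : Continuous (fun t : ℝ => max (-N) (min t N)) :=
  continuous_const.max (continuous_id.min continuous_const)

/-- Clamping lands in `[-N, N]` (plumbing). [folklore] -/
private theorem clampR_mem (N : ℝ) (hN : 0 ≤ N) (t : ℝ) : max (-N) (min t N) ∈ Set.Icc (-N) N :=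
  ⟨le_max_left _ _, max_le (by linarith) (min_le_right _ _)⟩

/-- Clamping fixes `[-N, N]` (plumbing). [folklore] -/
private theorem clampR_eq_self {N t : ℝ} (h : t ∈ Set.Icc (-N) N) : max (-N) (min t N) = t := by
  rw [min_eq_left h.2, max_eq_right h.1]

/-- **Density-free MTP₂ is preserved by continuous log-supermodular tilts, bounded or not.**  For a finite MTP₂
measure `µ` on `ℝ^ι` (Definition 2; singular allowed) and any continuous MTP₂ weight `ρ : ℝ^ι → ℝ≥0` — no bound,
no integrability assumed, so `ρ • µ` may be an infinite measure — `µ.withDensity ρ` satisfies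
`(ρµ)(A)(ρµ)(B) ≤ (ρµ)(A ∧ B)(ρµ)(A ∨ B)` for all Borel `A, B`.  Localisation: `µ` restricted to the sublattice
box `[-N,N]^ι` is MTP₂, `ρ` agrees there with the bounded continuous MTP₂ weight `ρ ∘ clamp_N` (clamping is a lattice
homomorphism), so `(ρµ)|_{[-N,N]^ι}` is MTP₂ by `mIsSetTP2.withDensity_of_continuous`; let `N → ∞` (continuity of
measure from below).  E.g. `e^{J Σ xᵢxⱼ} µ`, `J ≥ 0`.  [cite: KarlinRinott1980, (1.14) (density case);
ColangeloMullerScarsini2006, Thms. 1–2 (corollary; not stated there)] -/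
theorem mIsSetTP2.withDensity_of_continuous_unbounded {μ : Measure (ι → ℝ)} [IsFiniteMeasure μ]
    (hμ : mIsSetTP2 μ) {ρ : (ι → ℝ) → ℝ≥0} (hρc : Continuous ρ)
    (hρ : ∀ x y, ρ x * ρ y ≤ ρ (x ⊓ y) * ρ (x ⊔ y)) :
    mIsSetTP2 (μ.withDensity fun x => (ρ x : ℝ≥0∞)) := by
  set T := μ.withDensity fun x => (ρ x : ℝ≥0∞) with hT
  -- the boxes `K N = [-N, N]^ι` and the localised measures
  set K : ℕ → Set (ι → ℝ) := fun N => Set.Icc (fun _ => -(N : ℝ)) (fun _ => (N : ℝ)) with hK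
  have hKm : ∀ N, MeasurableSet (K N) := fun N => measurableSet_Icc
  have hKmono : Monotone K := fun N M hNM => Set.Icc_subset_Icc
    (fun i => neg_le_neg (Nat.cast_le.2 hNM)) (fun i => Nat.cast_le.2 hNM)
  have hKU : ∀ A : Set (ι → ℝ), ⋃ N, A ∩ K N = A := fun A => by
    rw [← Set.inter_iUnion]
    refine Set.inter_eq_left.2 fun x _ => ?_
    obtain ⟨N, hN⟩ := exists_nat_ge (‖x‖)
    refine Set.mem_iUnion.2 ⟨N, fun i => ?_, fun i => ?_⟩
    · exact (abs_le.1 ((norm_le_pi_norm x i).trans hN)).1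
    · exact (abs_le.1 ((norm_le_pi_norm x i).trans hN)).2
  -- each localisation is MTP₂
  have hloc : ∀ N : ℕ, mIsSetTP2 (T.restrict (K N)) := by
    intro N
    have hμN : mIsSetTP2 (μ.restrict (K N)) :=
      hμ.restrict_of_latticeClosed (hKm N)
        (fun x hx y hy => ⟨fun i => (hx.1 i).trans le_sup_left, fun i => sup_le (hx.2 i) (hy.2 i)⟩)
        (fun x hx y hy => ⟨fun i => le_inf (hx.1 i) (hy.1 i), fun i => inf_le_left.trans (hx.2 i)⟩)
    -- the clamped weight
    set ρN : (ι → ℝ) → ℝ≥0 := fun x => ρ fun i => max (-(N : ℝ)) (min (x i) N) with hρN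
    have hclamp_c : Continuous fun x : ι → ℝ => fun i => max (-(N : ℝ)) (min (x i) N) :=
      continuous_pi fun i => (continuous_clampR (N : ℝ)).comp (continuous_apply i)
    have hρNc : Continuous ρN := hρc.comp hclamp_c
    have hρNm : ∀ x y, ρN x * ρN y ≤ ρN (x ⊓ y) * ρN (x ⊔ y) := by
      intro x y
      have h1 : (fun i => max (-(N : ℝ)) (min ((x ⊓ y) i) N)) =
          (fun i => max (-(N : ℝ)) (min (x i) N)) ⊓ fun i => max (-(N : ℝ)) (min (y i) N) :=
        funext fun i => (clampR_mono (N : ℝ)).map_inf (x i) (y i)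
      have h2 : (fun i => max (-(N : ℝ)) (min ((x ⊔ y) i) N)) =
          (fun i => max (-(N : ℝ)) (min (x i) N)) ⊔ fun i => max (-(N : ℝ)) (min (y i) N) :=
        funext fun i => (clampR_mono (N : ℝ)).map_sup (x i) (y i)
      simp only [hρN, h1, h2]
      exact hρ _ _
    -- a bound for the clamped weight: `ρ` is bounded on the compact box
    have hKc : IsCompact (K N) := isCompact_Icc
    obtain ⟨C, hC⟩ : ∃ C : ℝ≥0, ∀ x, ρN x ≤ C := by
      obtain ⟨x₀, _, hx₀⟩ := hKc.exists_isMaxOn ⟨fun _ => 0, fun i => by simp, fun i => by simp⟩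
        hρc.continuousOn
      exact ⟨ρ x₀, fun x => hx₀ ⟨fun i => (clampR_mem (N : ℝ) N.cast_nonneg (x i)).1,
        fun i => (clampR_mem (N : ℝ) N.cast_nonneg (x i)).2⟩⟩
    have key := hμN.withDensity_of_continuous hρNc hρNm hC
    -- identify the two localised measures
    have hEq : (μ.restrict (K N)).withDensity (fun x => (ρN x : ℝ≥0∞)) = T.restrict (K N) := by
      rw [hT, restrict_withDensity (hKm N)]
      refine withDensity_congr_ae ((ae_restrict_iff' (hKm N)).2 (ae_of_all _ fun x hx => ?_))
      simp only [hρN]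
      congr 2
      exact funext fun i => clampR_eq_self ⟨hx.1 i, hx.2 i⟩
    rwa [hEq] at key
  -- pass to the limit `N → ∞`
  intro A B hA hB
  have hlim : ∀ E : Set (ι → ℝ), Tendsto (fun N => T.restrict (K N) E) atTop (𝓝 (T E)) := fun E => by
    have h := tendsto_measure_iUnion_atTop (μ := T) (s := fun N => E ∩ K N)
      (fun N M hNM => Set.inter_subset_inter_right _ (hKmono hNM))
    rw [hKU E] at h
    refine h.congr' (Eventually.of_forall fun N => ?_)
    exact (Measure.restrict_apply' (hKm N)).symm
  have hle : ∀ N, T.restrict (K N) A * T.restrict (K N) B ≤ T (A ⊼ B) * T (A ⊻ B) := fun N =>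
    (hloc N hA hB).trans (mul_le_mul' (Measure.restrict_apply_le _ _) (Measure.restrict_apply_le _ _))
  by_cases hA0 : T A = 0
  · simp [hA0]
  by_cases hB0 : T B = 0
  · simp [hB0]
  exact le_of_tendsto' (ENNReal.Tendsto.mul (hlim A) (Or.inl hA0) (hlim B) (Or.inl hB0)) hle

end Unbounded

end Literature.Probability.LatticeModels.Affiliation
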